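import Literature.Geometry.Kaehler.AlternatingFormInnerFrameBounds
import Literature.Geometry.Kaehler.ChartTorusL2
import Literature.NumberTheory.Transcendental.ComplexFormsSmoothProofs
import Literature.NumberTheory.Transcendental.KaehlerHodgePreHilbert
import Literature.NumberTheory.Transcendental.L2HodgeTheoryAddLeftProofs
import Literature.NumberTheory.Transcendental.FormIntegrationNonnegProofs
import Literature.Geometry.Kaehler.ManifoldFormsPullback
import Mathlib.Analysis.Normed.Module.Alternating.Basic
import Mathlib.Analysis.Complex.OperatorNorm
import Mathlib.Geometry.Manifold.Diffeomorph
import HarnessLib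

/-!
# Transported `(p,q)`-forms are almost of type `(p,q)`: the type projector under an almost
# complex-linear, almost isometric diffeomorphism

Topic: the type decomposition of complex forms on a complex manifold (Voisin (2002), §2.3.1) and
the `L²` metric on forms (§5.1.1), in a family. This is the "types converge" input of the *soft*
proof of the upper semicontinuity of the Hodge numbers `h^{p,q}(X_s)` of the fibres of a smooth
projective family (Voisin (2002), §9.3.2, Prop. 9.20, after Kodaira–Spencer): if `Φ : M₀ → M₁` is a
diffeomorphism whose differential is uniformly almost isometric and almost complex-linear, then
the pull-back `w = Φ^*u` of a `(p,q)`-form `u` of `M₁` is almost of type `(p,q)` on `M₀`, in `L²`: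
`‖w - w^{p,q}‖_{L²(M₀)} ≤ η ‖w‖_{L²(M₀)}` with `η → 0` as `DΦ` becomes complex-linear. Companion of
`AlternatingFormInnerTransport.lean` / `L2InnerTransport.lean` (metric comparison) and of
`Analysis/OperatorTheory/PerturbedSubspaceLimit.lean` (the abstract limiting argument).

* `norm_compContinuousLinearMap_sub_le` — `‖g ∘ Λ^k A - g ∘ Λ^k B‖ ≤ k max(‖A‖,‖B‖)^{k-1} ‖A - B‖ ‖g‖`
  (Mathlib's multilinearity of `A ↦ g ∘ Λ^k A` and `ContinuousMultilinearMap.norm_image_sub_le`);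
  `norm_sum_smul_compContinuousLinearMap_sub_le`, `norm_le_norm_symm_pow_mul_norm_compContinuousLinearMap`.
* `norm_sq_le_two_mul_alternatingFormInner_re_add_im`, `alternatingFormInner_re_add_im_le_two_mul_norm_sq`
  — operator norm of a complex covector versus its metric size `⟨Re h, Re h⟩ + ⟨Im h, Im h⟩`
  (`AlternatingFormInnerFrameBounds`, `ChartTorusL2`).
* `alternatingFormInner_re_add_im_typeDefect_le` — **pointwise**: for a covector `u` on `V₁` with
  `u ∘ Λ^k e^{iθⱼ} = e^{imθⱼ} u`, its transport `w = u ∘ Λ^k T` satisfies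
  `|w - N⁻¹ ∑ⱼ e^{-imθⱼ} w ∘ Λ^k e^{iθⱼ}|² ≤ 4 n^{2k} (k Λ^{k-1} σ^k)² κ² |w|²`, `κ` bounding the
  commutators `‖e^{iθⱼ} T - T e^{iθⱼ}‖`.
* `re_cl2Inner_typeDefect_le` — **integrated**: `Re (w - w^{p,q}, w - w^{p,q})_{L²} ≤ C κ² Re (w, w)_{L²}`
  for `w = Φ^*u`, `u` a smooth `(p,q)`-form (`integral_smul_riemannianVolumeForm_mono`).
* `norm_tangentRotate_of_inner_tangentJ`, `norm_tangentRotate_le_one`,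
  `norm_tangentRotate_comp_sub_comp_tangentRotate_le` — rotations of a Hermitian tangent space are
  isometries; `‖e^{iθ} T - T e^{iθ}‖ ≤ ‖J₁ T - T J₀‖`.
* `alternatingFormInner_compContinuousLinearMap_of_norm_map`, `norm_mk_compContinuousLinearMap_tangentRotate`,
  `exists_typeProjector_clm` — the type projector `w ↦ w^{p,q}` is a bounded operator (of norm `≤ 1`)
  on the Hermitian pre-Hilbert space `CL2SmoothForms o k` of a compact Hermitian manifold.

Everything is proved; no definition, no named fact.

## References

* C. Voisin, *Hodge Theory and Complex Algebraic Geometry I*, CUP (2002), §2.3.1 (types),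
  §3.1.1 Lemma 3.3 (Hermitian metrics), §5.1.1 eq. (5.1) (the `L²` metric), §9.3.2 Prop. 9.20;
  held text `book:voisin2002-hodge-theory-complex-algebraic-geometry-i`. [cite: VoisinHodgeI2002, §9.3.2]
* J. M. Lee, *Introduction to Smooth Manifolds*, 2nd ed. (2013), Prop. 16.6.
-/

noncomputable section

open Module ContinuousAlternatingMap Finset
open scoped Nat InnerProductSpace RealInnerProductSpace Manifold ContDiff Topology

namespace Literature.Geometry.Kaehler

/-! ### Perturbing the linear map inside `g ∘ Λ^k A` -/

section Normed

variable {V₀ V₁ G : Type*} [NormedAddCommGroup V₀] [NormedSpace ℝ V₀] [NormedAddCommGroup V₁]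
  [NormedSpace ℝ V₁] [NormedAddCommGroup G] [NormedSpace ℝ G] {k : ℕ}

/-- **Lipschitz dependence of `g ∘ Λ^k A` on `A`**:
`‖g ∘ Λ^k A - g ∘ Λ^k B‖ ≤ k · max(‖A‖, ‖B‖)^{k-1} · ‖A - B‖ · ‖g‖` (the map `A ↦ (g ↦ g ∘ Λ^k A)`
is continuous `k`-multilinear of norm `≤ 1` in `(A, …, A)`, Mathlib's
`compContinuousLinearMapContinuousMultilinear`, and `ContinuousMultilinearMap.norm_image_sub_le`).
[folklore] -/
theorem norm_compContinuousLinearMap_sub_le (g : V₁ [⋀^Fin k]→L[ℝ] G) (A B : V₀ →L[ℝ] V₁) :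
    ‖g.compContinuousLinearMap A - g.compContinuousLinearMap B‖ ≤
      k * max ‖A‖ ‖B‖ ^ (k - 1) * ‖A - B‖ * ‖g‖ := by
  set F := ContinuousMultilinearMap.compContinuousLinearMapContinuousMultilinear ℝ
    (fun _ : Fin k ↦ V₀) (fun _ : Fin k ↦ V₁) G with hF
  have hFn : ‖F‖ ≤ 1 := MultilinearMap.mkContinuous_norm_le _ zero_le_one _
  have hA : ‖(fun _ : Fin k ↦ A)‖ ≤ ‖A‖ := pi_norm_const_le A
  have hB : ‖(fun _ : Fin k ↦ B)‖ ≤ ‖B‖ := pi_norm_const_le B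
  have hAB : ‖(fun _ : Fin k ↦ A) - (fun _ : Fin k ↦ B)‖ ≤ ‖A - B‖ := pi_norm_const_le (A - B)
  have h1 := F.norm_image_sub_le (fun _ ↦ A) (fun _ ↦ B)
  rw [Fintype.card_fin] at h1
  have key : (g.compContinuousLinearMap A - g.compContinuousLinearMap B).toContinuousMultilinearMap =
      (F (fun _ ↦ A) - F (fun _ ↦ B)) g.toContinuousMultilinearMap := by
    ext v
    simp [hF, Function.comp_def]
  have h2 : ‖g.compContinuousLinearMap A - g.compContinuousLinearMap B‖ ≤
      ‖F (fun _ ↦ A) - F (fun _ ↦ B)‖ * ‖g‖ := by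
    have := (F (fun _ ↦ A) - F (fun _ ↦ B)).le_opNorm g.toContinuousMultilinearMap
    rw [← key] at this
    simpa only [norm_toContinuousMultilinearMap] using this
  have hmax : 0 ≤ max ‖A‖ ‖B‖ := le_max_of_le_left (norm_nonneg _)
  calc ‖g.compContinuousLinearMap A - g.compContinuousLinearMap B‖
      ≤ ‖F (fun _ ↦ A) - F (fun _ ↦ B)‖ * ‖g‖ := h2
    _ ≤ (‖F‖ * k * max ‖(fun _ : Fin k ↦ A)‖ ‖(fun _ : Fin k ↦ B)‖ ^ (k - 1) *
          ‖(fun _ : Fin k ↦ A) - (fun _ : Fin k ↦ B)‖) * ‖g‖ :=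
        mul_le_mul_of_nonneg_right h1 (norm_nonneg _)
    _ ≤ (1 * k * max ‖A‖ ‖B‖ ^ (k - 1) * ‖A - B‖) * ‖g‖ := by
        gcongr
    _ = k * max ‖A‖ ‖B‖ ^ (k - 1) * ‖A - B‖ * ‖g‖ := by ring

/-- **A weighted sum of such differences**: if `‖cⱼ‖ ≤ 1`, `‖Aⱼ‖, ‖Bⱼ‖ ≤ Λ` and `‖Aⱼ - Bⱼ‖ ≤ κ`,
then `‖∑ⱼ cⱼ (u ∘ Λ^k Aⱼ - u ∘ Λ^k Bⱼ)‖ ≤ N · k Λ^{k-1} κ ‖u‖`. [folklore] -/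
theorem norm_sum_smul_compContinuousLinearMap_sub_le (u : V₁ [⋀^Fin k]→L[ℝ] ℂ) {N : ℕ} (c : Fin N → ℂ)
    (A B : Fin N → (V₀ →L[ℝ] V₁)) {Λ κ : ℝ} (hΛ : 0 ≤ Λ) (hc : ∀ j, ‖c j‖ ≤ 1)
    (hA : ∀ j, ‖A j‖ ≤ Λ) (hB : ∀ j, ‖B j‖ ≤ Λ) (hAB : ∀ j, ‖A j - B j‖ ≤ κ) :
    ‖∑ j, c j • (u.compContinuousLinearMap (A j) - u.compContinuousLinearMap (B j))‖ ≤
      N * (k * Λ ^ (k - 1) * κ * ‖u‖) := by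
  have hj : ∀ j, ‖c j • (u.compContinuousLinearMap (A j) - u.compContinuousLinearMap (B j))‖ ≤
      k * Λ ^ (k - 1) * κ * ‖u‖ := by
    intro j
    rw [norm_smul]
    have h1 := norm_compContinuousLinearMap_sub_le u (A j) (B j)
    have hm : max ‖A j‖ ‖B j‖ ≤ Λ := max_le (hA j) (hB j)
    have hm0 : 0 ≤ max ‖A j‖ ‖B j‖ := le_max_of_le_left (norm_nonneg _)
    calc ‖c j‖ * ‖u.compContinuousLinearMap (A j) - u.compContinuousLinearMap (B j)‖
        ≤ 1 * (k * max ‖A j‖ ‖B j‖ ^ (k - 1) * ‖A j - B j‖ * ‖u‖) :=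
          mul_le_mul (hc j) h1 (norm_nonneg _) zero_le_one
      _ ≤ 1 * (k * Λ ^ (k - 1) * κ * ‖u‖) := by gcongr; exact hAB j
      _ = k * Λ ^ (k - 1) * κ * ‖u‖ := one_mul _
  calc ‖∑ j, c j • (u.compContinuousLinearMap (A j) - u.compContinuousLinearMap (B j))‖
      ≤ ∑ j, ‖c j • (u.compContinuousLinearMap (A j) - u.compContinuousLinearMap (B j))‖ :=
        norm_sum_le _ _
    _ ≤ ∑ _j : Fin N, k * Λ ^ (k - 1) * κ * ‖u‖ := sum_le_sum fun j _ ↦ hj j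
    _ = N * (k * Λ ^ (k - 1) * κ * ‖u‖) := by simp

/-- `‖g ∘ Λ^k S‖ ≤ ‖S‖^k ‖g‖`; used as `‖u‖ ≤ ‖T⁻¹‖^k ‖u ∘ Λ^k T‖` for `u = (u ∘ Λ^k T) ∘ Λ^k T⁻¹`. [folklore] -/
theorem norm_le_norm_symm_pow_mul_norm_compContinuousLinearMap (u : V₁ [⋀^Fin k]→L[ℝ] G)
    (T : V₀ ≃L[ℝ] V₁) :
    ‖u‖ ≤ ‖(T.symm : V₁ →L[ℝ] V₀)‖ ^ k * ‖u.compContinuousLinearMap (T : V₀ →L[ℝ] V₁)‖ := by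
  have hu : u = (u.compContinuousLinearMap (T : V₀ →L[ℝ] V₁)).compContinuousLinearMap
      (T.symm : V₁ →L[ℝ] V₀) := by
    ext v
    simp [Function.comp_def]
  conv_lhs => rw [hu]
  refine (norm_compContinuousLinearMap_le _ _).trans_eq ?_
  rw [Fintype.card_fin, mul_comm]

end Normed

/-! ### Complex covectors on a real inner product space: operator norm versus metric size -/

section Complex

variable {V : Type*} [NormedAddCommGroup V] [InnerProductSpace ℝ V] [FiniteDimensional ℝ V]
  {n : ℕ} [Fact (finrank ℝ V = n)] {k : ℕ}

/-- **Operator norm versus metric size of a complex covector**, first direction: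
`‖h‖² ≤ 2 nᵏ k! (⟨Re h, Re h⟩ + ⟨Im h, Im h⟩)` (`norm_sq_le_mul_alternatingFormInner_self` for the
real and imaginary parts). [folklore] -/
theorem norm_sq_le_two_mul_alternatingFormInner_re_add_im (h : V [⋀^Fin k]→L[ℝ] ℂ) :
    ‖h‖ ^ 2 ≤ 2 * ((n : ℝ) ^ k * (k ! : ℝ)) *
      (alternatingFormInner V n k (Complex.reCLM.compContinuousAlternatingMap h)
          (Complex.reCLM.compContinuousAlternatingMap h) +
        alternatingFormInner V n k (Complex.imCLM.compContinuousAlternatingMap h)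
          (Complex.imCLM.compContinuousAlternatingMap h)) := by
  have h1 := norm_le_norm_re_add_norm_im h
  have h2 := norm_sq_le_mul_alternatingFormInner_self (n := n)
    (Complex.reCLM.compContinuousAlternatingMap h)
  have h3 := norm_sq_le_mul_alternatingFormInner_self (n := n)
    (Complex.imCLM.compContinuousAlternatingMap h)
  have h4 : ‖h‖ ^ 2 ≤ (‖Complex.reCLM.compContinuousAlternatingMap h‖ +
      ‖Complex.imCLM.compContinuousAlternatingMap h‖) ^ 2 :=
    pow_le_pow_left₀ (norm_nonneg _) h1 2
  nlinarith [sq_nonneg (‖Complex.reCLM.compContinuousAlternatingMap h‖ -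
    ‖Complex.imCLM.compContinuousAlternatingMap h‖)]

/-- **Operator norm versus metric size of a complex covector**, second direction:
`⟨Re h, Re h⟩ + ⟨Im h, Im h⟩ ≤ 2 (k!)⁻¹ nᵏ ‖h‖²` (`alternatingFormInner_self_le`). [folklore] -/
theorem alternatingFormInner_re_add_im_le_two_mul_norm_sq (h : V [⋀^Fin k]→L[ℝ] ℂ) :
    alternatingFormInner V n k (Complex.reCLM.compContinuousAlternatingMap h)
          (Complex.reCLM.compContinuousAlternatingMap h) +
        alternatingFormInner V n k (Complex.imCLM.compContinuousAlternatingMap h)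
          (Complex.imCLM.compContinuousAlternatingMap h) ≤
      2 * (((k ! : ℝ))⁻¹ * (n : ℝ) ^ k) * ‖h‖ ^ 2 := by
  have h2 := alternatingFormInner_self_le (n := n) (Complex.reCLM.compContinuousAlternatingMap h)
  have h3 := alternatingFormInner_self_le (n := n) (Complex.imCLM.compContinuousAlternatingMap h)
  have hr : ‖Complex.reCLM.compContinuousAlternatingMap h‖ ^ 2 ≤ ‖h‖ ^ 2 :=
    pow_le_pow_left₀ (norm_nonneg _) (norm_reCLM_compContinuousAlternatingMap_le h) 2
  have hi : ‖Complex.imCLM.compContinuousAlternatingMap h‖ ^ 2 ≤ ‖h‖ ^ 2 :=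
    pow_le_pow_left₀ (norm_nonneg _) (norm_imCLM_compContinuousAlternatingMap_le h) 2
  have hC : 0 ≤ ((k ! : ℝ))⁻¹ * (n : ℝ) ^ k := by positivity
  have e2 := mul_le_mul_of_nonneg_left hr hC
  have e3 := mul_le_mul_of_nonneg_left hi hC
  linarith

end Complex

/-! ### The averaged difference at one point -/

section Pointwise

variable {V₀ : Type*} [NormedAddCommGroup V₀] [InnerProductSpace ℝ V₀] [FiniteDimensional ℝ V₀]
  {V₁ : Type*} [NormedAddCommGroup V₁] [InnerProductSpace ℝ V₁]
  {n : ℕ} [Fact (finrank ℝ V₀ = n)] {k : ℕ}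

/-- **The type defect of a transported covector, pointwise.** Let `u` be a complex `k`-covector on
`V₁` which is an eigenvector of the rotations `R₁ j` with eigenvalues `e j` (`u ∘ Λ^k (R₁ j) = e j • u`;
for a `(p,q)`-covector and `R₁ j = e^{iθⱼ}`, `e j = e^{i(p-q)θⱼ}`), `T : V₀ ≃ V₁`, `w = u ∘ Λ^k T`
its transport, and `D = w - N⁻¹ ∑ⱼ cⱼ • w ∘ Λ^k (R₀ j)` the defect of `w` under the corresponding
average on `V₀` (`cⱼ eⱼ = 1`, `‖cⱼ‖ ≤ 1`; for the `(p,q)`-projector `cⱼ = e^{-i(p-q)θⱼ}`). Since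
`∑ⱼ cⱼ u ∘ Λ^k (R₁ j ∘ T) = N w`, `D = N⁻¹ ∑ⱼ cⱼ (u ∘ Λ^k (R₁ j ∘ T) - u ∘ Λ^k (T ∘ R₀ j))`, whence,
with `‖R₁ j ∘ T‖, ‖T ∘ R₀ j‖ ≤ Λ`, `‖R₁ j ∘ T - T ∘ R₀ j‖ ≤ κ`, `‖T⁻¹‖ ≤ σ`:
`⟨Re D, Re D⟩ + ⟨Im D, Im D⟩ ≤ 4 n^{2k} (k Λ^{k-1} σ^k)² κ² (⟨Re w, Re w⟩ + ⟨Im w, Im w⟩)`.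
[folklore] -/
theorem alternatingFormInner_re_add_im_typeDefect_le (u : V₁ [⋀^Fin k]→L[ℝ] ℂ) (T : V₀ ≃L[ℝ] V₁)
    {N : ℕ} (hN : 0 < N) (c e : Fin N → ℂ) (R₀ : Fin N → (V₀ →L[ℝ] V₀)) (R₁ : Fin N → (V₁ →L[ℝ] V₁))
    (hu : ∀ j, u.compContinuousLinearMap (R₁ j) = e j • u) (hce : ∀ j, c j * e j = 1)
    (hc : ∀ j, ‖c j‖ ≤ 1) {Λ σ κ : ℝ} (hΛ : 0 ≤ Λ) (hκ : 0 ≤ κ)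
    (hσ : ‖(T.symm : V₁ →L[ℝ] V₀)‖ ≤ σ)
    (hA : ∀ j, ‖(R₁ j).comp (T : V₀ →L[ℝ] V₁)‖ ≤ Λ) (hB : ∀ j, ‖(T : V₀ →L[ℝ] V₁).comp (R₀ j)‖ ≤ Λ)
    (hAB : ∀ j, ‖(R₁ j).comp (T : V₀ →L[ℝ] V₁) - (T : V₀ →L[ℝ] V₁).comp (R₀ j)‖ ≤ κ)
    {w D : V₀ [⋀^Fin k]→L[ℝ] ℂ} (hw : w = u.compContinuousLinearMap (T : V₀ →L[ℝ] V₁))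
    (hD : D = w - (N : ℂ)⁻¹ • ∑ j, c j • w.compContinuousLinearMap (R₀ j)) :
    alternatingFormInner V₀ n k (Complex.reCLM.compContinuousAlternatingMap D)
          (Complex.reCLM.compContinuousAlternatingMap D) +
        alternatingFormInner V₀ n k (Complex.imCLM.compContinuousAlternatingMap D)
          (Complex.imCLM.compContinuousAlternatingMap D) ≤
      4 * (n : ℝ) ^ (2 * k) * ((k : ℝ) * Λ ^ (k - 1) * σ ^ k) ^ 2 * κ ^ 2 *
        (alternatingFormInner V₀ n k (Complex.reCLM.compContinuousAlternatingMap w)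
            (Complex.reCLM.compContinuousAlternatingMap w) +
          alternatingFormInner V₀ n k (Complex.imCLM.compContinuousAlternatingMap w)
            (Complex.imCLM.compContinuousAlternatingMap w)) := by
  have hσ0 : 0 ≤ σ := (norm_nonneg _).trans hσ
  -- rewrite the defect as an average of differences
  have hcomp : ∀ (f : V₀ →L[ℝ] V₁) (g : V₀ →L[ℝ] V₀),
      (u.compContinuousLinearMap f).compContinuousLinearMap g =
        u.compContinuousLinearMap (f.comp g) := fun f g ↦ by ext v; rfl
  have hcomp' : ∀ (g : V₁ →L[ℝ] V₁) (f : V₀ →L[ℝ] V₁),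
      (u.compContinuousLinearMap g).compContinuousLinearMap f =
        u.compContinuousLinearMap (g.comp f) := fun g f ↦ by ext v; rfl
  have hsumA : ∑ j, c j • u.compContinuousLinearMap ((R₁ j).comp (T : V₀ →L[ℝ] V₁)) =
      (N : ℂ) • w := by
    have : ∀ j, c j • u.compContinuousLinearMap ((R₁ j).comp (T : V₀ →L[ℝ] V₁)) = w := by
      intro j
      rw [← hcomp', hu j, hw]
      ext v
      simp only [ContinuousAlternatingMap.smul_apply, compContinuousLinearMap_apply, smul_eq_mul,
        ← mul_assoc, hce j, one_mul]
    simp only [this, sum_const, card_univ, Fintype.card_fin]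
    exact (Nat.cast_smul_eq_nsmul ℂ N w).symm
  have hDiff : D = (N : ℂ)⁻¹ • ∑ j, c j • (u.compContinuousLinearMap ((R₁ j).comp (T : V₀ →L[ℝ] V₁)) -
      u.compContinuousLinearMap ((T : V₀ →L[ℝ] V₁).comp (R₀ j))) := by
    have hN0 : (N : ℂ) ≠ 0 := by exact_mod_cast hN.ne'
    have h1 : ∑ j, c j • (u.compContinuousLinearMap ((R₁ j).comp (T : V₀ →L[ℝ] V₁)) -
        u.compContinuousLinearMap ((T : V₀ →L[ℝ] V₁).comp (R₀ j))) =
        (N : ℂ) • w - ∑ j, c j • w.compContinuousLinearMap (R₀ j) := by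
      simp only [smul_sub, sum_sub_distrib, hsumA, hw, hcomp]
    rw [hD, h1, smul_sub, smul_smul, inv_mul_cancel₀ hN0, one_smul]
  -- operator-norm estimate of the defect
  have hnormD : ‖D‖ ≤ (k : ℝ) * Λ ^ (k - 1) * κ * ‖u‖ := by
    rw [hDiff, norm_smul, norm_inv, Complex.norm_natCast]
    have h := norm_sum_smul_compContinuousLinearMap_sub_le u c
      (fun j ↦ (R₁ j).comp (T : V₀ →L[ℝ] V₁)) (fun j ↦ (T : V₀ →L[ℝ] V₁).comp (R₀ j)) hΛ hc hA hB hAB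
    have hN' : (0 : ℝ) < N := by exact_mod_cast hN
    calc (N : ℝ)⁻¹ * ‖∑ j, c j • (u.compContinuousLinearMap ((R₁ j).comp (T : V₀ →L[ℝ] V₁)) -
          u.compContinuousLinearMap ((T : V₀ →L[ℝ] V₁).comp (R₀ j)))‖
        ≤ (N : ℝ)⁻¹ * (N * (k * Λ ^ (k - 1) * κ * ‖u‖)) :=
          mul_le_mul_of_nonneg_left h (inv_nonneg.2 hN'.le)
      _ = k * Λ ^ (k - 1) * κ * ‖u‖ := by field_simp
  have hu_le : ‖u‖ ≤ σ ^ k * ‖w‖ := by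
    rw [hw]
    refine (norm_le_norm_symm_pow_mul_norm_compContinuousLinearMap u T).trans ?_
    exact mul_le_mul_of_nonneg_right (pow_le_pow_left₀ (norm_nonneg _) hσ k) (norm_nonneg _)
  have hw2 := norm_sq_le_two_mul_alternatingFormInner_re_add_im (n := n) w
  have hD2 := alternatingFormInner_re_add_im_le_two_mul_norm_sq (n := n) D
  set Qw := alternatingFormInner V₀ n k (Complex.reCLM.compContinuousAlternatingMap w)
      (Complex.reCLM.compContinuousAlternatingMap w) +
    alternatingFormInner V₀ n k (Complex.imCLM.compContinuousAlternatingMap w)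
      (Complex.imCLM.compContinuousAlternatingMap w) with hQw
  have hQw0 : 0 ≤ Qw := add_nonneg (alternatingFormInner_self_nonneg k _) (alternatingFormInner_self_nonneg k _)
  -- chain the estimates
  set a : ℝ := (k : ℝ) * Λ ^ (k - 1) * κ with ha
  have ha0 : 0 ≤ a := by positivity
  have hD1 : ‖D‖ ≤ a * σ ^ k * ‖w‖ := by
    calc ‖D‖ ≤ a * ‖u‖ := hnormD
      _ ≤ a * (σ ^ k * ‖w‖) := mul_le_mul_of_nonneg_left hu_le ha0
      _ = a * σ ^ k * ‖w‖ := by ring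
  have hD1sq : ‖D‖ ^ 2 ≤ (a * σ ^ k) ^ 2 * ‖w‖ ^ 2 := by
    rw [← mul_pow]
    exact pow_le_pow_left₀ (norm_nonneg _) (by simpa [mul_assoc] using hD1) 2
  have hfac : ((k ! : ℝ))⁻¹ * (n : ℝ) ^ k * ((n : ℝ) ^ k * (k ! : ℝ)) = (n : ℝ) ^ (2 * k) := by
    have hk : (k ! : ℝ) ≠ 0 := by positivity
    field_simp
    ring
  calc alternatingFormInner V₀ n k (Complex.reCLM.compContinuousAlternatingMap D)
          (Complex.reCLM.compContinuousAlternatingMap D) +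
        alternatingFormInner V₀ n k (Complex.imCLM.compContinuousAlternatingMap D)
          (Complex.imCLM.compContinuousAlternatingMap D)
      ≤ 2 * (((k ! : ℝ))⁻¹ * (n : ℝ) ^ k) * ‖D‖ ^ 2 := hD2
    _ ≤ 2 * (((k ! : ℝ))⁻¹ * (n : ℝ) ^ k) * ((a * σ ^ k) ^ 2 * ‖w‖ ^ 2) :=
        mul_le_mul_of_nonneg_left hD1sq (by positivity)
    _ ≤ 2 * (((k ! : ℝ))⁻¹ * (n : ℝ) ^ k) * ((a * σ ^ k) ^ 2 * (2 * ((n : ℝ) ^ k * (k ! : ℝ)) * Qw)) := by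
        gcongr
    _ = 4 * (n : ℝ) ^ (2 * k) * ((k : ℝ) * Λ ^ (k - 1) * σ ^ k) ^ 2 * κ ^ 2 * Qw := by
        rw [← hfac, ha]; ring

end Pointwise

/-! ### On a compact Hermitian manifold: the `L²` size of the type defect of a transported form -/

section Manifold

open Bundle Literature.NumberTheory.Transcendental

-- The identification `TangentSpace I x = E` is an abuse of definitional equality (see
-- `NormedSpace.fromTangentSpace`); as in Mathlib's tangent-bundle files we let `isDefEq` unfold it.
set_option backward.isDefEq.respectTransparency false

variable {E₀ : Type*} [NormedAddCommGroup E₀] [NormedSpace ℂ E₀] [FiniteDimensional ℂ E₀]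
  {n : ℕ} [Fact (finrank ℝ E₀ = n)] [MeasurableSpace E₀] [BorelSpace E₀]
  {M₀ : Type*} [TopologicalSpace M₀] [ChartedSpace E₀ M₀] [T2Space M₀] [CompactSpace M₀]
  [IsManifold 𝓘(ℝ, E₀) ∞ M₀]
  [RiemannianBundle (fun x : M₀ ↦ TangentSpace 𝓘(ℝ, E₀) x)]
  [IsContMDiffRiemannianBundle 𝓘(ℝ, E₀) ∞ E₀ (fun x : M₀ ↦ TangentSpace 𝓘(ℝ, E₀) x)]
  (o₀ : (x : M₀) → Orientation ℝ (TangentSpace 𝓘(ℝ, E₀) x) (Fin n))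

/-- **Monotonicity of `∫_M f vol`** in the smooth density `f` (compact manifold, smooth metric,
smooth `vol_o`): `f ≤ g` pointwise implies `∫ f vol ≤ ∫ g vol` — `∫ (g - f) vol ≥ 0`
(`integral_smul_riemannianVolumeForm_nonneg_holds`) and linearity (`MForm.integral_add_holds`,
`MForm.integral_smul`). Lee (2013), Prop. 16.6 (a), (c). [cite: LeeSmoothManifolds2013, Prop. 16.6] -/
theorem integral_smul_riemannianVolumeForm_mono (ho₀ : IsSmoothForm (riemannianVolumeForm o₀))
    {f g : M₀ → ℝ} (hf : IsSmoothForm (fun x ↦ f x • riemannianVolumeForm o₀ x))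
    (hg : IsSmoothForm (fun x ↦ g x • riemannianVolumeForm o₀ x)) (hfg : ∀ x, f x ≤ g x) :
    MForm.integral o₀ (fun x ↦ f x • riemannianVolumeForm o₀ x) ≤
      MForm.integral o₀ (fun x ↦ g x • riemannianVolumeForm o₀ x) := by
  haveI : IsContinuousRiemannianBundle E₀ (fun x : M₀ ↦ TangentSpace 𝓘(ℝ, E₀) x) :=
    isContinuousRiemannianBundle_of_isContMDiffRiemannianBundle 𝓘(ℝ, E₀) ∞
  have ho₀c : IsContinuousOrientation o₀ :=
    isContinuousOrientation_of_isSmoothForm_riemannianVolumeForm_holds o₀ ho₀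
  have hform : (fun x ↦ (g x - f x) • riemannianVolumeForm o₀ x) =
      (fun x ↦ g x • riemannianVolumeForm o₀ x) +
        (-1 : ℝ) • (fun x ↦ f x • riemannianVolumeForm o₀ x) := by
    funext x
    ext v
    simp only [Pi.add_apply, Pi.smul_apply, ContinuousAlternatingMap.add_apply,
      ContinuousAlternatingMap.smul_apply, smul_eq_mul]
    ring
  have h0 := integral_smul_riemannianVolumeForm_nonneg_holds o₀ (f := fun x ↦ g x - f x)
    fun x ↦ sub_nonneg.2 (hfg x)
  rw [hform, MForm.integral_add_holds o₀ ho₀c hg (hf.smul _), MForm.integral_smul] at h0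
  linarith

variable {E₁ : Type*} [NormedAddCommGroup E₁] [NormedSpace ℂ E₁]
  {M₁ : Type*} [TopologicalSpace M₁] [ChartedSpace E₁ M₁] [IsManifold 𝓘(ℝ, E₁) ∞ M₁]
  [RiemannianBundle (fun y : M₁ ↦ TangentSpace 𝓘(ℝ, E₁) y)]

/-- **The `L²` size of the type defect of a transported `(p,q)`-form.** Let `(M₀, g₀, o₀)` be a
compact Hermitian manifold (holomorphic atlas, smooth metric, smooth `vol_{o₀}`), `M₁` a complex
manifold with a Riemannian metric, `Φ : M₀ → M₁` a diffeomorphism, and `u` a smooth `(p,q)`-form on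
`M₁`, `w = Φ^* u`. If at every point `‖DΦ(x)⁻¹‖ ≤ σ`, `‖e^{iθⱼ} ∘ DΦ(x)‖, ‖DΦ(x) ∘ e^{iθⱼ}‖ ≤ Λ` and
`‖e^{iθⱼ} ∘ DΦ(x) - DΦ(x) ∘ e^{iθⱼ}‖ ≤ κ` for the angles `θⱼ = 2πj/(2k+1)` of the type projector
(`MForm.weightComponent`; the last quantity is `|sin θⱼ| ‖J₁ DΦ - DΦ J₀‖`, small when `DΦ` is
almost complex-linear), then
`Re (w - w^{p,q}, w - w^{p,q})_{L²} ≤ 4 n^{2k} (k Λ^{k-1} σ^k)² κ² · Re (w, w)_{L²}`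
(the pointwise estimate `alternatingFormInner_re_add_im_typeDefect_le`, integrated:
`integral_smul_riemannianVolumeForm_mono`). This is the "types converge" step of the soft proof of the
upper semicontinuity of `h^{p,q}` (Voisin (2002), §9.3.2, Prop. 9.20): transported `(p,q)`-forms of
nearby fibres are almost of type `(p,q)` on the central fibre.
[cite: VoisinHodgeI2002, §9.3.2, Prop. 9.20] -/
theorem re_cl2Inner_typeDefect_le [IsManifold 𝓘(ℂ, E₀) ω M₀]
    (ho₀ : IsSmoothForm (riemannianVolumeForm o₀)) (Φ : Diffeomorph 𝓘(ℝ, E₀) 𝓘(ℝ, E₁) M₀ M₁ ∞)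
    {k p q : ℕ} {u : MForm 𝓘(ℝ, E₁) M₁ ℂ k} (hus : IsSmoothForm u) (hu : IsOfType p q u)
    {Λ σ κ : ℝ} (hΛ : 0 ≤ Λ) (hκ : 0 ≤ κ)
    (hσ : ∀ x, ‖((Φ.mfderivToContinuousLinearEquiv (by simp) x).symm :
      TangentSpace 𝓘(ℝ, E₁) (Φ x) →L[ℝ] TangentSpace 𝓘(ℝ, E₀) x)‖ ≤ σ)
    (hA : ∀ x (j : Fin (2 * k + 1)),
      ‖(tangentRotate E₁ (Φ x) (2 * Real.pi * j / (2 * k + 1))).comp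
        (mfderiv 𝓘(ℝ, E₀) 𝓘(ℝ, E₁) Φ x)‖ ≤ Λ)
    (hB : ∀ x (j : Fin (2 * k + 1)),
      ‖(mfderiv 𝓘(ℝ, E₀) 𝓘(ℝ, E₁) Φ x).comp (tangentRotate E₀ x (2 * Real.pi * j / (2 * k + 1)))‖ ≤ Λ)
    (hAB : ∀ x (j : Fin (2 * k + 1)),
      ‖(tangentRotate E₁ (Φ x) (2 * Real.pi * j / (2 * k + 1))).comp
          (mfderiv 𝓘(ℝ, E₀) 𝓘(ℝ, E₁) Φ x) -
        (mfderiv 𝓘(ℝ, E₀) 𝓘(ℝ, E₁) Φ x).comp (tangentRotate E₀ x (2 * Real.pi * j / (2 * k + 1)))‖ ≤ κ) :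
    (MForm.cl2Inner o₀ (u.pullback 𝓘(ℝ, E₀) Φ - (u.pullback 𝓘(ℝ, E₀) Φ).typeComponent p q)
        (u.pullback 𝓘(ℝ, E₀) Φ - (u.pullback 𝓘(ℝ, E₀) Φ).typeComponent p q)).re ≤
      4 * (n : ℝ) ^ (2 * k) * ((k : ℝ) * Λ ^ (k - 1) * σ ^ k) ^ 2 * κ ^ 2 *
        (MForm.cl2Inner o₀ (u.pullback 𝓘(ℝ, E₀) Φ) (u.pullback 𝓘(ℝ, E₀) Φ)).re := by
  haveI : IsContinuousRiemannianBundle E₀ (fun x : M₀ ↦ TangentSpace 𝓘(ℝ, E₀) x) :=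
    isContinuousRiemannianBundle_of_isContMDiffRiemannianBundle 𝓘(ℝ, E₀) ∞
  have ho₀c : IsContinuousOrientation o₀ :=
    isContinuousOrientation_of_isSmoothForm_riemannianVolumeForm_holds o₀ ho₀
  set C : ℝ := 4 * (n : ℝ) ^ (2 * k) * ((k : ℝ) * Λ ^ (k - 1) * σ ^ k) ^ 2 * κ ^ 2 with hC
  set w := u.pullback 𝓘(ℝ, E₀) Φ with hw
  set D := w - w.typeComponent p q with hD
  have hws : IsSmoothForm w := isSmoothForm_pullback Φ.contMDiff hus
  have hDs : IsSmoothForm D := (smoothForms 𝓘(ℝ, E₀) M₀ ℂ k).sub_mem hws (hws.typeComponent p q)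
  -- `Re (X, X) = ∫ (⟨Re X, Re X⟩ + ⟨Im X, Im X⟩) vol`
  have hre : ∀ {X : MForm 𝓘(ℝ, E₀) M₀ ℂ k}, IsSmoothForm X → (MForm.cl2Inner o₀ X X).re =
      MForm.integral o₀ (fun x ↦ (MForm.inner n X.re X.re x + MForm.inner n X.im X.im x) •
        riemannianVolumeForm o₀ x) := by
    intro X hX
    have h1 : (MForm.cl2Inner o₀ X X).re = MForm.l2Inner o₀ X.re X.re + MForm.l2Inner o₀ X.im X.im := by
      simp only [MForm.cl2Inner, Complex.add_re, Complex.mul_re, Complex.ofReal_re,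
        Complex.ofReal_im, Complex.I_re, Complex.I_im]
      ring
    have h2 : (fun x ↦ (MForm.inner n X.re X.re x + MForm.inner n X.im X.im x) •
        riemannianVolumeForm o₀ x) =
        (fun x ↦ MForm.inner n X.re X.re x • riemannianVolumeForm o₀ x) +
          fun x ↦ MForm.inner n X.im X.im x • riemannianVolumeForm o₀ x := by
      funext x
      simp only [Pi.add_apply, add_smul]
    rw [h1, h2, MForm.integral_add_holds o₀ ho₀c (hX.re.inner_smul_riemannianVolumeForm hX.re o₀ ho₀)
      (hX.im.inner_smul_riemannianVolumeForm hX.im o₀ ho₀)]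
    rfl
  have hsmooth : ∀ {X : MForm 𝓘(ℝ, E₀) M₀ ℂ k}, IsSmoothForm X → IsSmoothForm
      (fun x ↦ (MForm.inner n X.re X.re x + MForm.inner n X.im X.im x) • riemannianVolumeForm o₀ x) := by
    intro X hX
    have h2 : (fun x ↦ (MForm.inner n X.re X.re x + MForm.inner n X.im X.im x) •
        riemannianVolumeForm o₀ x) =
        (fun x ↦ MForm.inner n X.re X.re x • riemannianVolumeForm o₀ x) +
          fun x ↦ MForm.inner n X.im X.im x • riemannianVolumeForm o₀ x := by
      funext x
      simp only [Pi.add_apply, add_smul]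
    rw [h2]
    exact (hX.re.inner_smul_riemannianVolumeForm hX.re o₀ ho₀).add
      (hX.im.inner_smul_riemannianVolumeForm hX.im o₀ ho₀)
  rw [hre hDs, hre hws]
  have hCint : C * MForm.integral o₀ (fun x ↦ (MForm.inner n w.re w.re x + MForm.inner n w.im w.im x) •
      riemannianVolumeForm o₀ x) = MForm.integral o₀ (fun x ↦
        (C * (MForm.inner n w.re w.re x + MForm.inner n w.im w.im x)) • riemannianVolumeForm o₀ x) := by
    rw [← MForm.integral_smul]
    congr 1
    funext x
    simp only [Pi.smul_apply, smul_smul]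
  rw [hCint]
  have hgs : IsSmoothForm (fun x ↦ (C * (MForm.inner n w.re w.re x + MForm.inner n w.im w.im x)) •
      riemannianVolumeForm o₀ x) := by
    have : (fun x ↦ (C * (MForm.inner n w.re w.re x + MForm.inner n w.im w.im x)) •
        riemannianVolumeForm o₀ x) = C • fun x ↦ (MForm.inner n w.re w.re x + MForm.inner n w.im w.im x) •
          riemannianVolumeForm o₀ x := by
      funext x
      simp only [Pi.smul_apply, smul_smul]
    rw [this]
    exact (hsmooth hws).smul C
  refine integral_smul_riemannianVolumeForm_mono o₀ ho₀ (hsmooth hDs) hgs fun x ↦ ?_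
  -- the pointwise estimate at `x`
  have hN : 0 < 2 * k + 1 := Nat.succ_pos _
  set T := Φ.mfderivToContinuousLinearEquiv (by simp) x with hT
  have hce : ∀ j : Fin (2 * k + 1),
      Complex.exp (-((((p : ℤ) - q : ℤ) : ℝ) * (2 * Real.pi * j / (2 * k + 1)) : ℝ) * Complex.I) *
        Complex.exp ((((p : ℤ) - q : ℤ)) * (2 * Real.pi * j / (2 * k + 1) : ℝ) * Complex.I) = 1 := by
    intro j
    rw [← Complex.exp_add, ← Complex.exp_zero]
    congr 1
    push_cast
    ring
  have hc : ∀ j : Fin (2 * k + 1),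
      ‖Complex.exp (-((((p : ℤ) - q : ℤ) : ℝ) * (2 * Real.pi * j / (2 * k + 1)) : ℝ) * Complex.I)‖ ≤ 1 := by
    intro j
    rw [← Complex.ofReal_neg, Complex.norm_exp_ofReal_mul_I]
  have hu' : ∀ j : Fin (2 * k + 1),
      (u (Φ x)).compContinuousLinearMap (tangentRotate E₁ (Φ x) (2 * Real.pi * j / (2 * k + 1))) =
        Complex.exp ((((p : ℤ) - q : ℤ)) * (2 * Real.pi * j / (2 * k + 1) : ℝ) * Complex.I) • u (Φ x) := by
    intro j
    ext v
    simp only [compContinuousLinearMap_apply, ContinuousAlternatingMap.smul_apply, smul_eq_mul]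
    exact hu.2 (Φ x) _ v
  have hDx : D x = w x - ((2 * k + 1 : ℕ) : ℂ)⁻¹ • ∑ j : Fin (2 * k + 1),
      Complex.exp (-((((p : ℤ) - q : ℤ) : ℝ) * (2 * Real.pi * j / (2 * k + 1)) : ℝ) * Complex.I) •
        (w x).compContinuousLinearMap (tangentRotate E₀ x (2 * Real.pi * j / (2 * k + 1))) := by
    have hTc : w.typeComponent p q = w.weightComponent ((p : ℤ) - q) := by
      rw [MForm.typeComponent, if_pos hu.1]
    rw [hD, Pi.sub_apply, hTc]
    rfl
  have key := alternatingFormInner_re_add_im_typeDefect_le (n := n) (u (Φ x)) T hN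
    (fun j : Fin (2 * k + 1) ↦
      Complex.exp (-((((p : ℤ) - q : ℤ) : ℝ) * (2 * Real.pi * j / (2 * k + 1)) : ℝ) * Complex.I))
    (fun j : Fin (2 * k + 1) ↦
      Complex.exp ((((p : ℤ) - q : ℤ)) * (2 * Real.pi * j / (2 * k + 1) : ℝ) * Complex.I))
    (fun j ↦ tangentRotate E₀ x (2 * Real.pi * j / (2 * k + 1)))
    (fun j ↦ tangentRotate E₁ (Φ x) (2 * Real.pi * j / (2 * k + 1)))
    hu' hce hc hΛ hκ (hσ x) (hA x) (hB x) (hAB x) (w := w x) (D := D x) rfl hDx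
  exact key

end Manifold

/-! ### Rotations of a Hermitian tangent space; the type projector as a bounded operator -/

section Projector

open Bundle Literature.NumberTheory.Transcendental

set_option backward.isDefEq.respectTransparency false

variable {V : Type*} [NormedAddCommGroup V] [InnerProductSpace ℝ V] [FiniteDimensional ℝ V]
  {n : ℕ} [Fact (finrank ℝ V = n)] {k : ℕ}

/-- **The metric on `k`-covectors is invariant under isometries**: if `R` preserves norms then
`⟨a ∘ Λ^k R, b ∘ Λ^k R⟩ = ⟨a, b⟩` (Warner's frame formula `alternatingFormInner_eq_inv_factorial_mul_sum`
in the orthonormal bases `e` and `R e`). [folklore] -/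
theorem alternatingFormInner_compContinuousLinearMap_of_norm_map (R : V →L[ℝ] V)
    (hR : ∀ v, ‖R v‖ = ‖v‖) (a b : V [⋀^Fin k]→L[ℝ] ℝ) :
    alternatingFormInner V n k (a.compContinuousLinearMap R) (b.compContinuousLinearMap R) =
      alternatingFormInner V n k a b := by
  set Rli : V →ₗᵢ[ℝ] V := { toLinearMap := (R : V →ₗ[ℝ] V), norm_map' := hR } with hRli
  set Re : V ≃ₗᵢ[ℝ] V := Rli.toLinearIsometryEquiv rfl with hRe
  set e := stdOrthonormalBasisFin V n
  rw [alternatingFormInner_eq_inv_factorial_mul_sum e, alternatingFormInner_eq_inv_factorial_mul_sum (e.map Re)]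
  congr 1

variable {E : Type*} [NormedAddCommGroup E] [NormedSpace ℂ E]
  {M : Type*} [TopologicalSpace M] [ChartedSpace E M]
  [RiemannianBundle (fun x : M ↦ TangentSpace 𝓘(ℝ, E) x)]

omit [FiniteDimensional ℝ V] [Fact (finrank ℝ V = n)] in
/-- **Rotations `e^{iθ}` of a Hermitian tangent space are isometries**: if `⟨Jv, Jw⟩ = ⟨v, w⟩`
then `‖cos θ v + sin θ Jv‖ = ‖v‖` (`⟨v, Jv⟩ = ⟨Jv, J²v⟩ = -⟨v, Jv⟩ = 0`). Voisin (2002), §3.1.1,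
Lemma 3.3. [cite: VoisinHodgeI2002, §3.1.1 Lemma 3.3] -/
theorem norm_tangentRotate_of_inner_tangentJ {x : M}
    (hJ : ∀ v w : TangentSpace 𝓘(ℝ, E) x, ⟪tangentJ E x v, tangentJ E x w⟫ = ⟪v, w⟫) (θ : ℝ)
    (v : TangentSpace 𝓘(ℝ, E) x) : ‖tangentRotate E x θ v‖ = ‖v‖ := by
  have h0 : ⟪v, tangentJ E x v⟫ = 0 := by
    have h1 := hJ v (tangentJ E x v)
    rw [tangentJ_tangentJ, inner_neg_right, real_inner_comm] at h1
    linarith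
  have hJJ : ‖tangentJ E x v‖ ^ 2 = ‖v‖ ^ 2 := by
    rw [← real_inner_self_eq_norm_sq, ← real_inner_self_eq_norm_sq, hJ]
  have hsq : ‖tangentRotate E x θ v‖ ^ 2 = ‖v‖ ^ 2 := by
    rw [tangentRotate_eq_cos_add_sin_tangentJ, norm_add_sq_real, norm_smul, norm_smul,
      real_inner_smul_left, real_inner_smul_right, h0, mul_pow, mul_pow, Real.norm_eq_abs,
      Real.norm_eq_abs, sq_abs, sq_abs, hJJ]
    linear_combination ‖v‖ ^ 2 * Real.cos_sq_add_sin_sq θ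
  exact (sq_eq_sq₀ (norm_nonneg _) (norm_nonneg _)).1 hsq

omit [FiniteDimensional ℝ V] [Fact (finrank ℝ V = n)] in
/-- `‖e^{iθ}‖ ≤ 1` as an operator on a Hermitian tangent space. [folklore] -/
theorem norm_tangentRotate_le_one {x : M}
    (hJ : ∀ v w : TangentSpace 𝓘(ℝ, E) x, ⟪tangentJ E x v, tangentJ E x w⟫ = ⟪v, w⟫) (θ : ℝ) :
    ‖tangentRotate E x θ‖ ≤ 1 :=
  ContinuousLinearMap.opNorm_le_bound _ zero_le_one fun v ↦ by
    rw [norm_tangentRotate_of_inner_tangentJ hJ θ v, one_mul]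

variable {E' : Type*} [NormedAddCommGroup E'] [NormedSpace ℂ E']
  {M' : Type*} [TopologicalSpace M'] [ChartedSpace E' M']
  [RiemannianBundle (fun y : M' ↦ TangentSpace 𝓘(ℝ, E') y)]

omit [FiniteDimensional ℝ V] [Fact (finrank ℝ V = n)] in
/-- **Commutator of a linear map with the rotations**: `e^{iθ} ∘ T - T ∘ e^{iθ} = sin θ (J' ∘ T - T ∘ J)`,
hence `‖e^{iθ} ∘ T - T ∘ e^{iθ}‖ ≤ ‖J' ∘ T - T ∘ J‖` — small when `T` is almost complex-linear.
[folklore] -/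
theorem norm_tangentRotate_comp_sub_comp_tangentRotate_le {x : M} {y : M'}
    (T : TangentSpace 𝓘(ℝ, E) x →L[ℝ] TangentSpace 𝓘(ℝ, E') y) (θ : ℝ) :
    ‖(tangentRotate E' y θ).comp T - T.comp (tangentRotate E x θ)‖ ≤
      ‖(tangentJ E' y).comp T - T.comp (tangentJ E x)‖ := by
  refine ContinuousLinearMap.opNorm_le_bound _
    (norm_nonneg ((tangentJ E' y).comp T - T.comp (tangentJ E x))) fun v ↦ ?_
  have hv : ((tangentRotate E' y θ).comp T - T.comp (tangentRotate E x θ)) v =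
      Real.sin θ • (((tangentJ E' y).comp T - T.comp (tangentJ E x)) v) := by
    change tangentRotate E' y θ (T v) - T (tangentRotate E x θ v) =
      Real.sin θ • (tangentJ E' y (T v) - T (tangentJ E x v))
    rw [tangentRotate_eq_cos_add_sin_tangentJ, tangentRotate_eq_cos_add_sin_tangentJ, map_add,
      map_smul, map_smul, smul_sub]
    abel
  rw [hv, norm_smul, Real.norm_eq_abs]
  calc |Real.sin θ| * ‖((tangentJ E' y).comp T - T.comp (tangentJ E x)) v‖
      ≤ 1 * (‖(tangentJ E' y).comp T - T.comp (tangentJ E x)‖ * ‖v‖) :=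
        mul_le_mul (Real.abs_sin_le_one θ) (ContinuousLinearMap.le_opNorm _ _) (norm_nonneg _)
          zero_le_one
    _ = ‖(tangentJ E' y).comp T - T.comp (tangentJ E x)‖ * ‖v‖ := one_mul _

variable [FiniteDimensional ℂ E] [Fact (finrank ℝ E = n)] [MeasurableSpace E] [BorelSpace E]
  [T2Space M] [CompactSpace M] [IsManifold 𝓘(ℝ, E) ∞ M]
  [IsContMDiffRiemannianBundle 𝓘(ℝ, E) ∞ E (fun x : M ↦ TangentSpace 𝓘(ℝ, E) x)]
  (o : (x : M) → Orientation ℝ (TangentSpace 𝓘(ℝ, E) x) (Fin n))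
  [Fact (IsSmoothForm (riemannianVolumeForm o))]

omit [FiniteDimensional ℝ V] [Fact (finrank ℝ V = n)] in
/-- **Pulling back along an isometric bundle map preserves the `L²` norm**: for the rotations
`e^{iθ}` of a Hermitian metric, `‖x ↦ w_x ∘ Λ^k e^{iθ}‖_{L²} = ‖w‖_{L²}` (pointwise
`alternatingFormInner_compContinuousLinearMap_of_norm_map` on real and imaginary parts). [folklore] -/
theorem norm_mk_compContinuousLinearMap_tangentRotate [IsManifold 𝓘(ℂ, E) ω M]
    (hJ : ∀ (x : M) (v w : TangentSpace 𝓘(ℝ, E) x), ⟪tangentJ E x v, tangentJ E x w⟫ = ⟪v, w⟫) (θ : ℝ)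
    {w : MForm 𝓘(ℝ, E) M ℂ k} (hw : IsSmoothForm w) :
    ‖CL2SmoothForms.mk o (fun x ↦ (w x).compContinuousLinearMap (tangentRotate E x θ) :
        MForm 𝓘(ℝ, E) M ℂ k) (hw.compContinuousLinearMap_tangentRotate θ)‖ =
      ‖CL2SmoothForms.mk o w hw‖ := by
  have hsq : ‖CL2SmoothForms.mk o (fun x ↦ (w x).compContinuousLinearMap (tangentRotate E x θ) :
        MForm 𝓘(ℝ, E) M ℂ k) (hw.compContinuousLinearMap_tangentRotate θ)‖ ^ 2 =
      ‖CL2SmoothForms.mk o w hw‖ ^ 2 := by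
    rw [CL2SmoothForms.norm_mk_sq_eq_add, CL2SmoothForms.norm_mk_sq_eq_add]
    have hre : ∀ x, MForm.inner n
        (MForm.re (fun x ↦ (w x).compContinuousLinearMap (tangentRotate E x θ) : MForm 𝓘(ℝ, E) M ℂ k))
        (MForm.re (fun x ↦ (w x).compContinuousLinearMap (tangentRotate E x θ) : MForm 𝓘(ℝ, E) M ℂ k)) x =
        MForm.inner n w.re w.re x := by
      intro x
      have h1 : (MForm.re (fun x ↦ (w x).compContinuousLinearMap (tangentRotate E x θ) :
          MForm 𝓘(ℝ, E) M ℂ k)) x = (w.re x).compContinuousLinearMap (tangentRotate E x θ) := by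
        ext v; rfl
      simp only [MForm.inner, h1]
      exact alternatingFormInner_compContinuousLinearMap_of_norm_map _
        (norm_tangentRotate_of_inner_tangentJ (hJ x) θ) _ _
    have him : ∀ x, MForm.inner n
        (MForm.im (fun x ↦ (w x).compContinuousLinearMap (tangentRotate E x θ) : MForm 𝓘(ℝ, E) M ℂ k))
        (MForm.im (fun x ↦ (w x).compContinuousLinearMap (tangentRotate E x θ) : MForm 𝓘(ℝ, E) M ℂ k)) x =
        MForm.inner n w.im w.im x := by
      intro x
      have h1 : (MForm.im (fun x ↦ (w x).compContinuousLinearMap (tangentRotate E x θ) :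
          MForm 𝓘(ℝ, E) M ℂ k)) x = (w.im x).compContinuousLinearMap (tangentRotate E x θ) := by
        ext v; rfl
      simp only [MForm.inner, h1]
      exact alternatingFormInner_compContinuousLinearMap_of_norm_map _
        (norm_tangentRotate_of_inner_tangentJ (hJ x) θ) _ _
    unfold MForm.l2Inner
    simp only [hre, him]
  exact (sq_eq_sq₀ (norm_nonneg _) (norm_nonneg _)).1 hsq

omit [FiniteDimensional ℝ V] [Fact (finrank ℝ V = n)] in
/-- **The type projector `w ↦ w^{p,q}` is a bounded operator on `(A^k(M; ℂ), ‖·‖_{L²})`** for a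
Hermitian metric on a compact complex manifold: it is `ℂ`-linear (`MForm.typeComponent_add/_smul`),
maps smooth forms to smooth forms (`IsSmoothForm.typeComponent`, holomorphic atlas), and is an
average of the `L²`-isometries `w ↦ w ∘ Λ^k e^{iθⱼ}` (`MForm.weightComponent`,
`norm_mk_compContinuousLinearMap_tangentRotate`), so `‖w^{p,q}‖ ≤ ‖w‖`. Stated as the existence of a
continuous linear `L` with `L w = w^{p,q}`. Voisin (2002), §2.3.1 and §5.1.1.
[cite: VoisinHodgeI2002, §5.1.1] -/
theorem exists_typeProjector_clm [IsManifold 𝓘(ℂ, E) ω M]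
    (hJ : ∀ (x : M) (v w : TangentSpace 𝓘(ℝ, E) x), ⟪tangentJ E x v, tangentJ E x w⟫ = ⟪v, w⟫) (p q : ℕ) :
    ∃ L : CL2SmoothForms o k →L[ℂ] CL2SmoothForms o k,
      ∀ v, CL2SmoothForms.toForm o (L v) = (CL2SmoothForms.toForm o v).typeComponent p q := by
  classical
  -- the linear map
  let Lₗ : CL2SmoothForms o k →ₗ[ℂ] CL2SmoothForms o k :=
    { toFun := fun v ↦ CL2SmoothForms.mk o ((CL2SmoothForms.toForm o v).typeComponent p q)
        ((CL2SmoothForms.isSmoothForm_toForm o v).typeComponent p q)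
      map_add' := fun v v' ↦ Subtype.ext (by
        simp only [CL2SmoothForms.toForm_add, MForm.typeComponent_add]; rfl)
      map_smul' := fun c v ↦ Subtype.ext (by
        simp only [CL2SmoothForms.toForm_smul, MForm.typeComponent_smul, RingHom.id_apply]; rfl) }
  have hL : ∀ v, CL2SmoothForms.toForm o (Lₗ v) = (CL2SmoothForms.toForm o v).typeComponent p q :=
    fun v ↦ rfl
  refine ⟨Lₗ.mkContinuous 1 fun v ↦ ?_, fun v ↦ hL v⟩
  rw [one_mul]
  by_cases hpq : p + q = k
  · set w := CL2SmoothForms.toForm o v with hwdef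
    have hw : IsSmoothForm w := CL2SmoothForms.isSmoothForm_toForm o v
    -- `L v` as an average of rotated forms in `A^k(M; ℂ)`
    have hsum : Lₗ v = ((2 * k + 1 : ℕ) : ℂ)⁻¹ • ∑ j : Fin (2 * k + 1),
        Complex.exp (-((((p : ℤ) - q : ℤ) : ℝ) * (2 * Real.pi * j / (2 * k + 1)) : ℝ) * Complex.I) •
          CL2SmoothForms.mk o (fun x ↦ (w x).compContinuousLinearMap
            (tangentRotate E x (2 * Real.pi * j / (2 * k + 1))) : MForm 𝓘(ℝ, E) M ℂ k)
            (hw.compContinuousLinearMap_tangentRotate _) := by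
      have hinj : ∀ a b : CL2SmoothForms o k,
          CL2SmoothForms.toForm o a = CL2SmoothForms.toForm o b → a = b := fun a b h ↦ Subtype.ext h
      apply hinj
      rw [hL]
      conv_rhs => rw [← CL2SmoothForms.toFormₗ_apply o, map_smul, _root_.map_sum]
      simp only [map_smul, CL2SmoothForms.toFormₗ_apply, CL2SmoothForms.toForm_mk]
      rw [← hwdef, MForm.typeComponent, if_pos hpq, MForm.weightComponent_eq_sum_compContinuousLinearMap]
    rw [hsum, norm_smul, norm_inv, Complex.norm_natCast]
    have hN : (0 : ℝ) < (2 * k + 1 : ℕ) := by positivity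
    calc ((2 * k + 1 : ℕ) : ℝ)⁻¹ * ‖∑ j : Fin (2 * k + 1),
          Complex.exp (-((((p : ℤ) - q : ℤ) : ℝ) * (2 * Real.pi * j / (2 * k + 1)) : ℝ) * Complex.I) •
            CL2SmoothForms.mk o (fun x ↦ (w x).compContinuousLinearMap
              (tangentRotate E x (2 * Real.pi * j / (2 * k + 1))) : MForm 𝓘(ℝ, E) M ℂ k)
              (hw.compContinuousLinearMap_tangentRotate _)‖
        ≤ ((2 * k + 1 : ℕ) : ℝ)⁻¹ * ∑ j : Fin (2 * k + 1), ‖v‖ := by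
          refine mul_le_mul_of_nonneg_left ((norm_sum_le _ _).trans (sum_le_sum fun j _ ↦ ?_))
            (inv_nonneg.2 hN.le)
          have hv : CL2SmoothForms.mk o w hw = v := rfl
          rw [norm_smul, ← Complex.ofReal_neg, Complex.norm_exp_ofReal_mul_I, one_mul,
            norm_mk_compContinuousLinearMap_tangentRotate o hJ _ hw, hv]
      _ = ‖v‖ := by
          rw [sum_const, card_univ, Fintype.card_fin, nsmul_eq_mul]
          field_simp
  · have h0 : Lₗ v = 0 := Subtype.ext (by
      change (CL2SmoothForms.toForm o v).typeComponent p q = _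
      rw [MForm.typeComponent_of_ne hpq]; rfl)
    rw [h0, norm_zero]
    exact norm_nonneg _

end Projector

end Literature.Geometry.Kaehler
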